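import Summits.CriticalPhenomena.CardyFormulaZ2.Theorems.CardySelfRefinementLagHandOffKernelFlatLink
import HarnessLib

/-!
# The flat-boundary link, diameter form of the far hypothesis: stub
`stub_kernel_flatMisdockLink2` of line `hitting-tournament` for crux `LagHandOff`
(stmt-CriticalPhenomena-10268)

The LINK brick of the flat boundary kernel of seat c6 with the quantifier fix of its FAR
hypothesis.  Notation as in the landed `stub_kernel_flatMisdockLink`
(`CardySelfRefinementLagHandOffKernelFlatLink.lean`): `E` is ADMISSIBLE discrete Dobrushin data
at mesh `E.δ`, `ω ⊆ E(ℤ²)` a bond configuration, `ω° := ω ∩ E(Ω_δ)` its trace on the edges of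
`Ω_δ = discreteDomainGraph E.Ω E.δ`, and `K(c)` the set of sites joined to the non-arc site
`c ∈ Ω_δ` by `ω°`-open paths inside `Ω_δ ∖ (arcs)`.  Suppose

* FLATNESS: in the lattice box `[j - M, j + N + M] × [b - 1, b + M]` every site lies in `Ω_δ`,
  the sites of row `b - 1` are exactly the sites of the discrete arc of `A` there, no site lies on
  the discrete arc of `B`, and `ℤ²`-neighbours inside the box are `Ω_δ`-neighbours;
* `4R + H + 2δ ≤ Mδ`;
* MISDOCK: no `ω`-open contact edge of `Ω_δ` into the arc of `A` is reachable from `c`;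
* DIAMETER (the new far hypothesis): two sites `y₁, y₂ ∈ K(c)` are at distance `≥ 6R` from each
  other.

Then for every LOWEST low strip site `z ∈ K(c)` and every radius `R' ∈ [δ, R]` whose half-disc
`W = {v | b ≤ v 1 ∧ dist (δv, δz) ≤ 4R'}` stays inside the strip columns, (i) `z` is lowest in
its raw-`ω` cluster inside `W`, (ii) the row-`b` sites of that cluster have closed legs into row
`b - 1`, (iii) that cluster reaches distance `3R'` from `z`.

Proof.  Steps (a), (i), (ii) are those of `stub_kernel_flatMisdockLink` verbatim (they do not
use the far hypothesis): (a) every site of `W` is a non-arc box site of `Ω_δ`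
(`KernelFlatLink.abs_re_sub_le_dist` / `abs_im_sub_le_dist`) and `ω`-open lattice edges inside
`W` are `ω°`-edges, so a raw-`ω` connection inside `W` from `z` is an `ω°`-connection inside
`Ω_δ ∖ arcs` from `c` (`exists_walk_of_mem_openConnIn` / `mem_openConnIn_of_walk` /
`PlanarDuality.openConnIn_trans`); (i) is the LOWEST hypothesis; (ii) an open leg would be an
open contact edge into the arc of `A` reachable from `c`, contradicting MISDOCK.  (iii) By the
triangle inequality `6R ≤ dist (y₁, y₂) ≤ dist (y₁, z) + dist (y₂, z)`, one of `y₁, y₂`, call it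
`y`, is at distance `≥ 3R ≥ 3R'` from `z`; this is the only place where the old proof consumed
its far site.  Walk along an `ω°`-open lattice walk inside `Ω_δ ∖ arcs` from `z` to `y`, stop at
the FIRST vertex at distance `≥ 3R'` from `z` (`KernelFlatLink.exists_walk_firstHit`); the prefix
stays within `3R' + δ ≤ 4R'` of `z` (`dist_meshPoint_of_adj`) and its rows stay `≥ b`
(`KernelFlatLink.walk_rows_ge`), so it is a raw-`ω`-open walk inside `W`.

Only the helpers of the sub-namespace `KernelFlatLink` of the imported LINK file, the
walk ↔ `openConnIn` bookkeeping of `PlanarDuality.lean` / `BoxCrossingProofs.lean`, and Mathlib's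
`SimpleGraph.Walk` API are used.
-/

noncomputable section

open Set Metric
open Literature.Probability.Percolation Literature.Probability.LatticeModels

namespace Summit.CriticalPhenomena.CardyFormulaZ2.Cruxes.LagHandOff.HittingTournament

open KernelFlatLink in
/-- **LINK2 `stub_kernel_flatMisdockLink2` (diameter form of the far hypothesis).** Under a flat
piece of the wired arc (the lattice box `[j - M, j + N + M] × [b - 1, b + M]` lies in `Ω_δ`, its
row `b - 1` is exactly the arc of `A` there, no arc-`B` sites, `ℤ²`-neighbours in the box are
`Ω_δ`-neighbours, `4R + H + 2δ ≤ Mδ`), a MISDOCKED `ω°`-cluster `K(c)` (no open contact edge into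
the arc of `A` reachable from `c`) of DIAMETER `≥ 6R` (two of its sites are at mesh distance
`≥ 6R`) satisfies, at each of its LOWEST low strip sites `z` and each radius `R' ∈ [δ, R]` whose
half-disc `W` of radius `4R'` about `z` stays in the strip columns: (i) `z` is lowest in its
raw-`ω` cluster inside `W`; (ii) the row-`b` sites `w` of that cluster have closed legs
`{w - e₁, w}`; (iii) that cluster reaches distance `3R'` from `z`.  (a) sites of `W` are non-arc
box sites of `Ω_δ` and `ω`-open lattice edges inside `W` are `ω°`-edges, so the raw cluster
inside `W` is part of `K(c)`; (i) LOWEST; (ii) an open leg would be an open contact into the arc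
of `A`, contradicting MISDOCK; (iii) by the triangle inequality one of the two diameter sites is
at distance `≥ 3R ≥ 3R'` from `z`, and the `ω°`-walk from `z` to it, stopped at the first vertex
at distance `≥ 3R'`, stays inside `W` (distance `< 3R' + δ ≤ 4R'`, rows `≥ b` by discrete
continuity). -/
theorem stub_kernel_flatMisdockLink2 :
    ∀ (E : DiscreteDobrushin), E.IsZdAdmissible → ∀ (ω : BondConfig (Site 2)) (b j : ℤ) (N M : ℕ) (c : Site 2) (H R : ℝ),
      ω ⊆ (zdGraph 2).edgeSet → 0 ≤ H → 0 < R →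
      (∀ v : Site 2, j - M ≤ v 0 → v 0 ≤ j + N + M → b - 1 ≤ v 1 → v 1 ≤ b + M →
        v ∈ meshDomain E.Ω E.δ ∧ (v ∈ E.zdArcA ↔ v 1 = b - 1) ∧ v ∉ E.zdArcB) →
      (∀ v w : Site 2, j - M ≤ v 0 → v 0 ≤ j + N + M → b - 1 ≤ v 1 → v 1 ≤ b + M →
        j - M ≤ w 0 → w 0 ≤ j + N + M → b - 1 ≤ w 1 → w 1 ≤ b + M →
        (zdGraph 2).Adj v w → (discreteDomainGraph E.Ω E.δ).Adj v w) →
      4 * R + H + 2 * E.δ ≤ M * E.δ →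
      c ∈ meshDomain E.Ω E.δ → c ∉ E.zdArcA ∪ E.zdArcB →
      (¬ ∃ u u' : Site 2, u' ∈ E.zdArcA ∧ u ∉ E.zdArcA ∪ E.zdArcB ∧ s(u, u') ∈ ω ∧
          s(u, u') ∈ (discreteDomainGraph E.Ω E.δ).edgeSet ∧
          (ω ∩ (discreteDomainGraph E.Ω E.δ).edgeSet) ∈
            openConnIn (meshDomain E.Ω E.δ \ (E.zdArcA ∪ E.zdArcB)) c u) →
      (∃ y₁ y₂ : Site 2, (ω ∩ (discreteDomainGraph E.Ω E.δ).edgeSet) ∈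
            openConnIn (meshDomain E.Ω E.δ \ (E.zdArcA ∪ E.zdArcB)) c y₁ ∧
          (ω ∩ (discreteDomainGraph E.Ω E.δ).edgeSet) ∈
            openConnIn (meshDomain E.Ω E.δ \ (E.zdArcA ∪ E.zdArcB)) c y₂ ∧
          6 * R ≤ dist (meshPoint E.δ y₁) (meshPoint E.δ y₂)) →
      ∀ z : Site 2, (ω ∩ (discreteDomainGraph E.Ω E.δ).edgeSet) ∈
            openConnIn (meshDomain E.Ω E.δ \ (E.zdArcA ∪ E.zdArcB)) c z →
        j ≤ z 0 → z 0 ≤ j + N → b ≤ z 1 → ((z 1 - b : ℤ) : ℝ) * E.δ ≤ H →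
        (∀ y : Site 2, (ω ∩ (discreteDomainGraph E.Ω E.δ).edgeSet) ∈
              openConnIn (meshDomain E.Ω E.δ \ (E.zdArcA ∪ E.zdArcB)) c y →
            j ≤ y 0 → y 0 ≤ j + N → b ≤ y 1 → z 1 ≤ y 1) →
        ∀ R' : ℝ, E.δ ≤ R' → R' ≤ R → (j : ℝ) * E.δ + 4 * R' ≤ (z 0 : ℝ) * E.δ →
          (z 0 : ℝ) * E.δ + 4 * R' ≤ ((j + N : ℤ) : ℝ) * E.δ →
          (∀ w : Site 2, ω ∈ openConnIn {v : Site 2 | b ≤ v 1 ∧ dist (meshPoint E.δ v) (meshPoint E.δ z) ≤ 4 * R'} z w →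
              z 1 ≤ w 1) ∧
          (∀ w : Site 2, ω ∈ openConnIn {v : Site 2 | b ≤ v 1 ∧ dist (meshPoint E.δ v) (meshPoint E.δ z) ≤ 4 * R'} z w →
              w 1 = b → s(w - Pi.single 1 1, w) ∉ ω) ∧
          (∃ w : Site 2, ω ∈ openConnIn {v : Site 2 | b ≤ v 1 ∧ dist (meshPoint E.δ v) (meshPoint E.δ z) ≤ 4 * R'} z w ∧
              3 * R' ≤ dist (meshPoint E.δ w) (meshPoint E.δ z)) := by
  intro E hE ω b j N M c H R hωE _hH _hR hflat hadjflat hM _hc _hcA hmis hfar z hz hjz hzN hbz hzH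
    hlow R' hδR' hR'R hleft hright
  have hδ : 0 < E.δ := hE.delta_pos
  have hzH' : (((z 1 : ℤ) : ℝ) - b) * E.δ ≤ H := by push_cast at hzH; exact hzH
  -- (a) coordinates of the sites within `4R'` of `z`
  have hcoord : ∀ v : Site 2, dist (meshPoint E.δ v) (meshPoint E.δ z) ≤ 4 * R' →
      j ≤ v 0 ∧ v 0 ≤ j + N ∧ v 1 ≤ b + M - 2 := by
    intro v hv
    have h0 := (abs_re_sub_le_dist E.δ v z).trans hv
    have h1 := (abs_im_sub_le_dist E.δ v z).trans hv
    rw [abs_le] at h0 h1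
    refine ⟨?_, ?_, ?_⟩
    · have h : (j : ℝ) * E.δ ≤ ((v 0 : ℤ) : ℝ) * E.δ := by linarith [h0.1]
      exact Int.cast_le.1 (le_of_mul_le_mul_right h hδ)
    · have h : ((v 0 : ℤ) : ℝ) * E.δ ≤ ((j + N : ℤ) : ℝ) * E.δ := by linarith [h0.2]
      exact Int.cast_le.1 (le_of_mul_le_mul_right h hδ)
    · have h : ((v 1 : ℤ) : ℝ) * E.δ ≤ ((b + M - 2 : ℤ) : ℝ) * E.δ := by
        push_cast
        linarith [h1.2]
      exact Int.cast_le.1 (le_of_mul_le_mul_right h hδ)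
  -- sites of the half-disc `W` are non-arc box sites of `Ω_δ`
  have hWS : ∀ v : Site 2, b ≤ v 1 → dist (meshPoint E.δ v) (meshPoint E.δ z) ≤ 4 * R' →
      v ∈ meshDomain E.Ω E.δ \ (E.zdArcA ∪ E.zdArcB) ∧
        j - M ≤ v 0 ∧ v 0 ≤ j + N + M ∧ b - 1 ≤ v 1 ∧ v 1 ≤ b + M := by
    intro v hbv hv
    obtain ⟨hv1, hv2, hv3⟩ := hcoord v hv
    have hb1 : j - M ≤ v 0 := by omega
    have hb2 : v 0 ≤ j + N + M := by omega
    have hb3 : b - 1 ≤ v 1 := by omega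
    have hb4 : v 1 ≤ b + M := by omega
    obtain ⟨hvD, hvAiff, hvB⟩ := hflat v hb1 hb2 hb3 hb4
    have hvA : v ∉ E.zdArcA := fun h => by
      have := hvAiff.1 h
      omega
    exact ⟨⟨hvD, fun h => h.elim hvA hvB⟩, hb1, hb2, hb3, hb4⟩
  -- a raw-`ω` connection inside `W` from `z` is an `ω°`-connection inside `Ω_δ ∖ arcs` from `c`
  have htrans : ∀ w : Site 2,
      ω ∈ openConnIn {v : Site 2 | b ≤ v 1 ∧ dist (meshPoint E.δ v) (meshPoint E.δ z) ≤ 4 * R'} z w →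
        (ω ∩ (discreteDomainGraph E.Ω E.δ).edgeSet) ∈
          openConnIn (meshDomain E.Ω E.δ \ (E.zdArcA ∪ E.zdArcB)) c w := by
    intro w hw
    obtain ⟨p, hpW, hpω⟩ := exists_walk_of_mem_openConnIn hωE hw
    refine PlanarDuality.openConnIn_trans hz
      (mem_openConnIn_of_walk p (fun x hx => (hWS x (hpW x hx).1 (hpW x hx).2).1) fun e he => ?_)
    refine ⟨hpω e he, ?_⟩
    obtain ⟨d, hd, rfl⟩ := List.mem_map.1 he
    have hd1 := hpW _ (p.dart_fst_mem_support_of_mem_darts hd)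
    have hd2 := hpW _ (p.dart_snd_mem_support_of_mem_darts hd)
    obtain ⟨-, a1, a2, a3, a4⟩ := hWS _ hd1.1 hd1.2
    obtain ⟨-, b1, b2, b3, b4⟩ := hWS _ hd2.1 hd2.2
    exact (SimpleGraph.mem_edgeSet _).2 (hadjflat _ _ a1 a2 a3 a4 b1 b2 b3 b4 d.adj)
  refine ⟨fun w hw => ?_, fun w hw hwb => ?_, ?_⟩
  · -- (i) `z` is lowest in its raw cluster inside `W`
    obtain ⟨-, ⟨hbw, hwdist⟩, -⟩ := id hw
    obtain ⟨hw1, hw2, -⟩ := hcoord w hwdist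
    exact hlow w (htrans w hw) hw1 hw2 hbw
  · -- (ii) the leg of a row-`b` site of the cluster is closed
    intro hleg
    obtain ⟨-, ⟨hbw, hwdist⟩, -⟩ := id hw
    obtain ⟨⟨-, hwA⟩, w1, w2, w3, w4⟩ := hWS w hbw hwdist
    have hu0 : (w - Pi.single 1 1 : Site 2) 0 = w 0 := by simp
    have hu1 : (w - Pi.single 1 1 : Site 2) 1 = b - 1 := by simp [hwb]
    obtain ⟨-, huAiff, -⟩ := hflat (w - Pi.single 1 1) (by omega) (by omega) (by omega) (by omega)
    have hDadj : (discreteDomainGraph E.Ω E.δ).Adj w (w - Pi.single 1 1) :=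
      hadjflat w (w - Pi.single 1 1) w1 w2 w3 w4 (by omega) (by omega) (by omega) (by omega)
        (adj_sub_single_one w)
    refine hmis ⟨w, w - Pi.single 1 1, huAiff.2 hu1, hwA, ?_, (SimpleGraph.mem_edgeSet _).2 hDadj,
      htrans w hw⟩
    rw [Sym2.eq_swap]
    exact hleg
  · -- (iii) the cluster reaches distance `3R'` from `z`
    obtain ⟨y₁, y₂, hy₁, hy₂, hdiam⟩ := hfar
    -- by the triangle inequality one of the two diameter sites is at distance `≥ 3R` from `z`
    obtain ⟨y, hy, hyfar⟩ : ∃ y : Site 2, (ω ∩ (discreteDomainGraph E.Ω E.δ).edgeSet) ∈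
        openConnIn (meshDomain E.Ω E.δ \ (E.zdArcA ∪ E.zdArcB)) c y ∧
        3 * R ≤ dist (meshPoint E.δ y) (meshPoint E.δ z) := by
      by_cases h₁ : 3 * R ≤ dist (meshPoint E.δ y₁) (meshPoint E.δ z)
      · exact ⟨y₁, hy₁, h₁⟩
      · refine ⟨y₂, hy₂, ?_⟩
        have htri := dist_triangle (meshPoint E.δ y₁) (meshPoint E.δ z) (meshPoint E.δ y₂)
        rw [dist_comm (meshPoint E.δ z) (meshPoint E.δ y₂)] at htri
        have h₁' := lt_of_not_ge h₁
        linarith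
    have hzy : (ω ∩ (discreteDomainGraph E.Ω E.δ).edgeSet) ∈
        openConnIn (meshDomain E.Ω E.δ \ (E.zdArcA ∪ E.zdArcB)) z y :=
      PlanarDuality.openConnIn_trans (by rw [openConnIn_comm]; exact hz) hy
    have hω'E : ω ∩ (discreteDomainGraph E.Ω E.δ).edgeSet ⊆ (zdGraph 2).edgeSet :=
      fun e he => hωE he.1
    obtain ⟨p, hpS, hpω'⟩ := exists_walk_of_mem_openConnIn hω'E hzy
    have hPy : 3 * R' ≤ dist (meshPoint E.δ y) (meshPoint E.δ z) := le_trans (by linarith) hyfar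
    obtain ⟨w, q, hPw, hqsupp, hqedges, hqdarts⟩ :=
      exists_walk_firstHit (fun x : Site 2 => 3 * R' ≤ dist (meshPoint E.δ x) (meshPoint E.δ z))
        p hPy
    -- every vertex of the prefix is within `4R'` of `z`
    have hqdist : ∀ x ∈ q.support, dist (meshPoint E.δ x) (meshPoint E.δ z) ≤ 4 * R' := by
      intro x hx
      rw [← SimpleGraph.Walk.cons_map_snd_darts, List.mem_cons, List.mem_map] at hx
      rcases hx with rfl | ⟨d, hd, rfl⟩
      · rw [dist_self]
        linarith
      · show dist (meshPoint E.δ d.snd) (meshPoint E.δ z) ≤ 4 * R'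
        have h1 : dist (meshPoint E.δ d.fst) (meshPoint E.δ z) < 3 * R' :=
          lt_of_not_ge (hqdarts d hd)
        have h2 : dist (meshPoint E.δ d.snd) (meshPoint E.δ d.fst) ≤ E.δ := by
          rw [dist_meshPoint_of_adj d.adj.symm, abs_of_pos hδ]
        have h3 := dist_triangle (meshPoint E.δ d.snd) (meshPoint E.δ d.fst) (meshPoint E.δ z)
        linarith
    have hqS : ∀ x ∈ q.support, x ∈ meshDomain E.Ω E.δ \ (E.zdArcA ∪ E.zdArcB) :=
      fun x hx => hpS x (hqsupp x hx)
    -- rows stay `≥ b` along the prefix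
    have hqrow : ∀ x ∈ q.support, b ≤ x 1 :=
      walk_rows_ge (A := E.zdArcA) (B := fun v : Site 2 => j - M ≤ v 0 ∧ v 0 ≤ j + N + M) (b := b)
        (fun v hB heq => (hflat v hB.1 hB.2 (by omega) (by omega)).2.1.2 heq) q
        (fun v hv => by
          obtain ⟨hv1, hv2, -⟩ := hcoord v (hqdist v hv)
          exact ⟨⟨by omega, by omega⟩, fun h => (hqS v hv).2 (Or.inl h)⟩) hbz
    exact ⟨w, mem_openConnIn_of_walk q (fun x hx => ⟨hqrow x hx, hqdist x hx⟩)
      (fun e he => (hpω' e (hqedges e he)).1), hPw⟩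

end Summit.CriticalPhenomena.CardyFormulaZ2.Cruxes.LagHandOff.HittingTournament

end
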